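import Mathlib
import Summits.ABC.IUTFork.Joshi.Multiplicatoids
import Summits.ABC.IUTFork.Joshi.MultiplicatoidsModel
import HarnessLib

/-!
# Joshi, ATS III §11 Prop. 11.1.1 — the SHEAF clause of the perfect multiplicatoid, in kernel (support file, no node)

Proof-only companion (plus two bookkeeping definitions and one witness presheaf) of `Joshi/Multiplicatoids.lean` (p431265,
seat abc-iut-E-t11, slot T-54; abc-iut cell, block E, rung LADDER-ABC:A2.E). Writer: abc-iut-E-t39 (gen 2), reader of record of
the T-54 file (ASSIGNMENTS v2.2 §2 T-39/T-54), reader-companion DERIVABLE row (E-plan-2 RULINGS 09:05:34Z policy lines; author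
released 09:05Z). Source: K. Joshi, *Construction of Arithmetic Teichmüller Spaces III*, arXiv:2401.13508 **v4** (unrefereed,
«Preliminary version for comments»; bib `Joshi2024ATS3`), §11.1 Prop. 11.1.1, PDF p.142 l.13–28 of the cell's render
`HOME/lit/renders/Joshi-arxiv-2401.13508/p0142.txt`. TAKES NO SIDE on [IUTchIII] Cor. 3.12, on Joshi's claims or on Mochizuki's
report on them; typed ≠ proved ≠ endorsed; §11 is spine App / class P4 (cited by no node on a path to S) — registry completeness,
not test material. Nothing of OUR interface is imported.

WHAT THE STATEMENT FILE LEFT ABSTRACT. Prop. 11.1.1 as printed: «Consider the (inverse) limit presheaf `O*pf_X = lim←_n (O*_X, φ_n)`.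
Then `O*pf_X` is a sheaf of abelian groups whose sections over open subsets (and hence also stalks) are perfect monoids … i.e.
the stalks are ℚ-vector spaces. Proof. … limits of sheaves of abelian groups exists and are sheaves of abelian groups» (p.142
l.19–28). In p431265 the typed `Prop1111 P sheafClause` PROVES the sections clause and carries the sheaf clause as an ABSTRACT
`sheafClause : Prop`; E-t11's own model file p433086 records that, as typed, «the Proposition's content is exactly its sheaf
clause» (`prop1111_true` / `not_prop1111_false`). THIS FILE supplies the honest clause and proves it:

* `UnitsPresheaf.toPresheaf` — E-t11's restriction data `(F, res)` on `Opens X` read as a MATHLIB presheaf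
  `TopCat.Presheaf (Type _) (TopCat.of X)`; `UnitsPresheaf.IsSheaf P := P.toPresheaf.IsSheaf` — Mathlib's sheaf condition
  (`TopCat.Presheaf.IsSheaf`, the Grothendieck-topology one; for `Type`-valued presheaves equivalent to unique gluing,
  `TopCat.Presheaf.isSheaf_iff_isSheafUniqueGluing_types`), NOT a hand-rolled predicate.
* `UnitsPresheaf.perfection_isSheaf : P.IsSheaf → P.perfection.IsSheaf` — PROVED: print's one-line proof «limits of sheaves …
  are sheaves», done coordinatewise (glue each coordinate `n` of a compatible family of compatible families; the coherence
  `t_{m·k}^k = t_m` of the glued coordinates is the UNIQUENESS of gluing at coordinate `m`).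
* `prop1111_of_isSheaf : P.IsSheaf → Prop1111 P P.perfection.IsSheaf` — [J-III] Prop. 11.1.1 AS PRINTED, in kernel: input
  «`O*_X` is a sheaf of abelian groups» (the typed hypothesis), output «`O*pf_X` is a sheaf whose sections are uniquely divisible».
* «and hence also stalks» (l.22–26): the `k`-th power map is an ISOMORPHISM of the perfected presheaf (`powNatIso`), hence a
  bijection on every Mathlib stalk (`perfection_stalk_pow_bijective`) — the stalks are uniquely divisible.
* NON-VACUITY, both horns: the presheaf of ALL `A`-valued functions on opens IS a sheaf in this sense (`funPresheaf_isSheaf`, so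
  `prop1111_funPresheaf` is an instance of the Proposition with an honest, TRUE sheaf clause), while p433086's constant presheaf
  with nontrivial `A` is NOT (`not_isSheaf_constPresheaf`: the empty cover of `⊥` forces `F(⊥)` to be a singleton) — the clause is
  contentful.
Standard axioms only; sorry-free; no statement of Joshi's is asserted beyond what is proved.
-/

noncomputable section

open TopologicalSpace Opposite CategoryTheory

universe u v

namespace Summit.ABC.IUTFork.Joshi.ATS3.Multiplicatoids

namespace UnitsPresheaf

/-! ## 1. E-t11's `UnitsPresheaf` on `Opens X` as a Mathlib presheaf; the sheaf condition -/

section ToPresheaf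

variable {X : Type u} [TopologicalSpace X] {F : Opens X → Type v} [∀ U, CommGroup (F U)]

/-- The units presheaf `(O*_X(U), res)` of [J-III] Prop. 11.1.1 (p.142 l.13–21; typed as `UnitsPresheaf (Opens X) F` in p431265)
read as a Mathlib `Type`-valued presheaf on the space `X`: sections `F U`, restriction along `V ≤ U` = E-t11's `res`
(bookkeeping; no content of Joshi's). [folklore] -/
abbrev toPresheaf (P : UnitsPresheaf (Opens X) F) : TopCat.Presheaf (Type v) (TopCat.of X) where
  obj U := F U.unop
  map f := TypeCat.ofHom (P.res f.unop.le)
  map_id U := by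
    refine ConcreteCategory.hom_ext _ _ fun a => ?_
    change P.res (le_refl U.unop) a = a
    rw [P.res_self]
    rfl
  map_comp {U V W} f g := by
    refine ConcreteCategory.hom_ext _ _ fun a => ?_
    change P.res (f ≫ g).unop.le a = P.res g.unop.le (P.res f.unop.le a)
    have h := P.res_comp g.unop.le f.unop.le
    exact (congrArg (fun φ : F U.unop →* F W.unop => φ a) h).symm

/-- Sections of `toPresheaf` over `U` are `F U`. [folklore] -/
theorem toPresheaf_obj (P : UnitsPresheaf (Opens X) F) (U : (Opens (TopCat.of X))ᵒᵖ) :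
    P.toPresheaf.obj U = F U.unop := rfl

/-- Restriction in `toPresheaf` is E-t11's `res`. [folklore] -/
theorem toPresheaf_map_apply (P : UnitsPresheaf (Opens X) F) {U V : (Opens (TopCat.of X))ᵒᵖ} (f : U ⟶ V)
    (a : F U.unop) : P.toPresheaf.map f a = P.res f.unop.le a := rfl

/-- **The sheaf clause of [J-III] Prop. 11.1.1, typed honestly** (p.142 l.21–22 «`O*pf_X` is a sheaf of abelian groups»; proof
l.27–28): a units presheaf on `Opens X` IS A SHEAF when its underlying Mathlib presheaf of sets satisfies Mathlib's sheaf
condition `TopCat.Presheaf.IsSheaf` (for presheaves of groups the condition is the set-level one). This is the `Prop` that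
p431265's `Prop1111 P sheafClause` left abstract; the notion is Mathlib's / standard, not Joshi's. [folklore] -/
def IsSheaf (P : UnitsPresheaf (Opens X) F) : Prop := P.toPresheaf.IsSheaf

/-- The sheaf clause unfolded to UNIQUE GLUING (Mathlib `isSheaf_iff_isSheafUniqueGluing_types`): every family of sections on an
open cover that agrees on pairwise intersections glues to exactly one section on the union. [folklore] -/
theorem isSheaf_iff_uniqueGluing (P : UnitsPresheaf (Opens X) F) :
    P.IsSheaf ↔ P.toPresheaf.IsSheafUniqueGluing :=
  TopCat.Presheaf.isSheaf_iff_isSheafUniqueGluing_types P.toPresheaf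

/-- Coordinates of the perfected presheaf's restriction: `(res a)_n = res (a_n)` (E-t11's `MulPerfection.map_apply`). [folklore] -/
theorem perfection_toPresheaf_map_coord (P : UnitsPresheaf (Opens X) F) {U V : (Opens (TopCat.of X))ᵒᵖ} (f : U ⟶ V)
    (a : MulPerfection (F U.unop)) (n : ℕ+) :
    ((P.perfection.toPresheaf.map f a : MulPerfection (F V.unop)) : ℕ+ → F V.unop) n =
      P.res f.unop.le ((a : ℕ+ → F U.unop) n) := rfl

end ToPresheaf

/-! ## 2. «Limits of sheaves are sheaves»: the perfection of a sheaf of groups is a sheaf (Prop. 11.1.1, proof l.27–28) -/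

section Perfection

variable {X : Type u} [TopologicalSpace X] {F : Opens X → Type v} [∀ U, CommGroup (F U)]

/-- **PROVED — the sheaf clause of [J-III] Prop. 11.1.1** (p.142 l.19–22, l.27–28 «the (inverse) limit presheaf … is a sheaf of
abelian groups … limits of sheaves of abelian groups exists and are sheaves»): if the units presheaf `O*_X` is a sheaf, so is its
perfection `O*pf_X = lim←_n (O*_X, x ↦ xⁿ)`. Proof, coordinatewise: a compatible family of compatible families `(s_i)_i` glues, for
each `n ≥ 1`, to a unique section `t_n` with `t_n|_{U_i} = (s_i)_n`; for `n = m·k` both `t_n^k` and `t_m` glue the family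
`((s_i)_m)_i`, so they coincide by UNIQUENESS — `(t_n)_n` is a compatible family, it glues `(s_i)_i`, and it is the only gluing
since its coordinates are forced. [claim: Joshi2024ATS3, status: disputed] -/
theorem perfection_isSheaf (P : UnitsPresheaf (Opens X) F) (h : P.IsSheaf) : P.perfection.IsSheaf := by
  rw [isSheaf_iff_uniqueGluing] at h ⊢
  intro ι U sf hsf
  -- the coordinate families are compatible for `P`
  have hcoord : ∀ n : ℕ+,
      P.toPresheaf.IsCompatible U fun i => ((sf i : MulPerfection (F (U i))) : ℕ+ → F (U i)) n := by
    intro n i j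
    have hij := congrArg (fun a : MulPerfection (F (U i ⊓ U j)) => (a : ℕ+ → F (U i ⊓ U j)) n) (hsf i j)
    exact hij
  choose t ht htu using fun n => h U _ (hcoord n)
  -- `t : ℕ+ → F (iSup U)` glues coordinatewise; it is a compatible family by uniqueness of gluing
  have hmem : (fun n => t n) ∈ MulPerfection (F (iSup U)) := by
    intro m n k hk
    refine htu m (t n ^ k) fun i => ?_
    have hti := ht n i
    rw [toPresheaf_map_apply] at hti ⊢
    rw [map_pow, hti]
    exact (sf i).2 m n k hk
  refine ⟨⟨fun n => t n, hmem⟩, fun i => ?_, fun y hy => ?_⟩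
  · -- it glues the given family
    refine Subtype.ext (funext fun n => ?_)
    have hti := ht n i
    rw [toPresheaf_map_apply] at hti
    rw [perfection_toPresheaf_map_coord]
    exact hti
  · -- and it is the only gluing: coordinates are forced
    refine Subtype.ext (funext fun n => htu n _ fun i => ?_)
    have hyi := congrArg (fun a : MulPerfection (F (U i)) => (a : ℕ+ → F (U i)) n) (hy i)
    exact hyi

/-- **[J-III] Proposition 11.1.1 AS PRINTED, in kernel** (p.142 l.13–28): for a units presheaf `O*_X` that IS A SHEAF of abelian
groups (the typed input — for a scheme or analytic space `O*_X` is one), the perfection `O*pf_X` is a sheaf (Mathlib's sheaf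
condition) whose sections over every open are uniquely divisible — i.e. E-t11's `Prop1111 P sheafClause` HOLDS with the sheaf
clause instantiated honestly by `P.perfection.IsSheaf`. [claim: Joshi2024ATS3, status: disputed] -/
theorem prop1111_of_isSheaf (P : UnitsPresheaf (Opens X) F) (h : P.IsSheaf) : Prop1111 P P.perfection.IsSheaf :=
  (prop1111_iff_sheafClause P _).2 (P.perfection_isSheaf h)

/-- Conversely the honest instance of `Prop1111` SAYS the perfection is a sheaf (bookkeeping: the clause is not decorative).
[folklore] -/
theorem perfection_isSheaf_of_prop1111 (P : UnitsPresheaf (Opens X) F) (h : Prop1111 P P.perfection.IsSheaf) :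
    P.perfection.IsSheaf :=
  (prop1111_iff_sheafClause P _).1 h

end Perfection

/-! ## 3. «and hence also stalks»: the power maps are isomorphisms of the perfected presheaf, so bijective on stalks -/

section Stalks

variable {X : Type u} [TopologicalSpace X] {F : Opens X → Type u} [∀ U, CommGroup (F U)]

/-- The `k`-th power map `a ↦ a^k` as an endomorphism of the perfected presheaf `O*pf_X` (a natural transformation: restriction
maps are group homomorphisms). [claim: Joshi2024ATS3, status: disputed] -/
def powNatTrans (P : UnitsPresheaf (Opens X) F) (k : ℕ+) : P.perfection.toPresheaf ⟶ P.perfection.toPresheaf where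
  app U := TypeCat.ofHom fun a : MulPerfection (F U.unop) => a ^ (k : ℕ)
  naturality U V f := by
    refine ConcreteCategory.hom_ext _ _ fun a => ?_
    change (P.perfection.res f.unop.le a) ^ (k : ℕ) = P.perfection.res f.unop.le (a ^ (k : ℕ))
    rw [map_pow]

/-- PROVED: each component of the power map is a bijection (E-t11's `MulPerfection.pow_bijective`), so the power map is an
ISOMORPHISM of presheaves. [folklore] -/
theorem isIso_powNatTrans (P : UnitsPresheaf (Opens X) F) (k : ℕ+) : IsIso (P.powNatTrans k) := by
  have : ∀ U : (Opens (TopCat.of X))ᵒᵖ, IsIso ((P.powNatTrans k).app U) := fun U =>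
    (bijective_iff_isIso_ofHom _).1 (MulPerfection.pow_bijective (A := F U.unop) k)
  exact NatIso.isIso_of_isIso_app _

/-- The power map as a natural ISOMORPHISM `O*pf_X ≅ O*pf_X`. [folklore] -/
def powNatIso (P : UnitsPresheaf (Opens X) F) (k : ℕ+) : P.perfection.toPresheaf ≅ P.perfection.toPresheaf :=
  haveI := P.isIso_powNatTrans k
  asIso (P.powNatTrans k)

/-- **PROVED — «(and hence also stalks) are perfect monoids»** ([J-III] Prop. 11.1.1, p.142 l.22–26 «… i.e. the stalks are
ℚ-vector spaces»): on the Mathlib STALK of the perfected presheaf at any point `x`, the map induced by `a ↦ a^k` is a bijection for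
every `k ≥ 1` — every germ has a unique `k`-th root (unique divisibility of stalks; a uniquely divisible abelian group is a
ℚ-vector space). Obtained functorially: an isomorphism of presheaves induces an isomorphism of stalks. [claim: Joshi2024ATS3, status: disputed] -/
theorem perfection_stalk_pow_bijective (P : UnitsPresheaf (Opens X) F) (x : X) (k : ℕ+) :
    Function.Bijective ((TopCat.Presheaf.stalkFunctor (Type u) (x : TopCat.of X)).map (P.powNatTrans k)) := by
  haveI := P.isIso_powNatTrans k
  exact (isIso_iff_bijective _).1 inferInstance

end Stalks

end UnitsPresheaf

/-! ## 4. Non-vacuity: a units presheaf that IS a sheaf (all functions), and one that is NOT (p433086's constant presheaf) -/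

section Witnesses

variable (X : Type u) [TopologicalSpace X] (A : Type u) [CommGroup A]

/-- The units presheaf of ALL `A`-valued functions on opens, `U ↦ (U → A)` with restriction of functions (the unit group of the
sheaf of all `R`-valued functions when `A = Rˣ`) — a witness that `UnitsPresheaf.IsSheaf` is satisfiable. [folklore] -/
def funPresheaf : UnitsPresheaf (Opens X) fun U : Opens X => (U → A) where
  res h :=
    { toFun := fun g => g ∘ Set.inclusion h
      map_one' := rfl
      map_mul' := fun _ _ => rfl }
  res_self _ := rfl
  res_comp _ _ := rfl

/-- PROVED: the presheaf of all `A`-valued functions is a sheaf in the sense of `UnitsPresheaf.IsSheaf` — its underlying Mathlib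
presheaf is Mathlib's `presheafToType`, a sheaf by `TopCat.Presheaf.toType_isSheaf` (functions glue uniquely). [folklore] -/
theorem funPresheaf_isSheaf : (funPresheaf X A).IsSheaf :=
  TopCat.Presheaf.toType_isSheaf (TopCat.of X) A

/-- PROVED: hence the perfection of the function presheaf is a sheaf and [J-III] Prop. 11.1.1 holds for it with an honest, TRUE
sheaf clause — the kernel form of the Proposition is not vacuous. [folklore] -/
theorem prop1111_funPresheaf : Prop1111 (funPresheaf X A) (funPresheaf X A).perfection.IsSheaf :=
  UnitsPresheaf.prop1111_of_isSheaf _ (funPresheaf_isSheaf X A)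

/-- PROVED (what the sheaf clause costs at the empty open): for ANY units presheaf that is a sheaf, the sections over the empty
open `⊥` form a singleton — the sheaf condition for the EMPTY cover is unique gluing of the empty family. [folklore] -/
theorem UnitsPresheaf.subsingleton_bot_of_isSheaf {F : Opens X → Type v} [∀ U, CommGroup (F U)]
    (P : UnitsPresheaf (Opens X) F) (h : P.IsSheaf) (a b : F ⊥) : a = b := by
  rw [UnitsPresheaf.isSheaf_iff_uniqueGluing] at h
  obtain ⟨s, -, hs⟩ :=
    h (fun i : PEmpty.{u + 1} => (i.elim : Opens (TopCat.of X))) (fun i => i.elim) (fun i => i.elim)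
  have h1 : iSup (fun i : PEmpty.{u + 1} => (i.elim : Opens (TopCat.of X))) ≤ (⊥ : Opens X) := (iSup_of_empty _).le
  have h2 : (⊥ : Opens X) ≤ iSup (fun i : PEmpty.{u + 1} => (i.elim : Opens (TopCat.of X))) := bot_le
  -- over the empty union all sections are gluings of the empty family, hence equal
  have hW : P.res h1 a = P.res h1 b := (hs (P.res h1 a) fun i => i.elim).trans (hs (P.res h1 b) fun i => i.elim).symm
  -- and restriction `⊥ ≤ ⨆ ∅ ≤ ⊥` is the identity
  have key : ∀ c : F ⊥, P.res h2 (P.res h1 c) = c := fun c => by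
    have hc := congrArg (fun φ : F (⊥ : Opens X) →* F ⊥ => φ c) ((P.res_comp h2 h1).trans (P.res_self ⊥))
    exact hc
  rw [← key a, ← key b, hW]

/-- PROVED (the other horn): p433086's CONSTANT units presheaf `U ↦ A` with identity restrictions (`constPresheaf`) is NOT a sheaf
as soon as `A` is nontrivial — its sections over `⊥` are all of `A`, not a singleton. So the sheaf clause of Prop. 11.1.1 is
contentful: `Prop1111 (constPresheaf (Opens X) A) (…).IsSheaf` is not automatic, while `prop1111_funPresheaf` holds. [folklore] -/
theorem not_isSheaf_constPresheaf [Nontrivial A] : ¬ (constPresheaf (Opens X) A).IsSheaf := by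
  intro h
  obtain ⟨a, b, hab⟩ := exists_pair_ne A
  exact hab (UnitsPresheaf.subsingleton_bot_of_isSheaf X (constPresheaf (Opens X) A) h a b)

end Witnesses

end Summit.ABC.IUTFork.Joshi.ATS3.Multiplicatoids

end
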